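import Literature.NumberTheory.LFunctions.ExceptionalPrimesWindows
import HarnessLib

/-!
# The geometric window scheme for Heath-Brown's lemma: parameters and elementary inequalities

Topic `Literature/NumberTheory/LFunctions`. Everything in this file is PROVED (theorems only);
seventh support file of the elementary proof of Heath-Brown's lemma on exceptional primes
(`ExceptionalPrimesSparse.lean`). No number theory here: only the bookkeeping of the windows
`(q^{a_{j+1}}, q^{a_j}]`, `a_j = 4 (10/11)^j`, `j < J = ⌊log μ / log(11/10)⌋`, `μ = √(log η)`,
each used with `m_j = ⌈(11/10)^{j+1}⌉`-fold products (`ExceptionalPrimesWindows.window_sum_le`),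
and the decay estimates that turn `J` window bounds of size `(41/η)^{1/m_j}` into `O(1/μ)`:

* `log_eleven_tenths_bounds` — `1/11 ≤ log(11/10) ≤ 1/10`;
* `geomIndex_bounds` — `(11/10)^J ≤ μ < (11/10)^{J+1}` and `J ≤ 11 log μ` for `μ ≥ 1`;
* `window_params` — for every `j`: `0 < a_{j+1} < a_j ≤ 4`, `a_j ≤ 1.1 a_{j+1}`, `2 ≤ m_j`,
  `4 ≤ a_{j+1} m_j`, `a_j m_j ≤ 8.4`; `ceil_pow_le_of_lt` — `m_j ≤ μ + 1` for `j < J`;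
* `rpow_inv_le_rpow_inv` — `x^{1/m} ≤ x^{1/(μ+1)}` for `0 ≤ x ≤ 1`, `1 ≤ m ≤ μ + 1`;
* `rpow_inv_le_exp_of_log_le` — `y^{1/(μ+1)} ≤ e^{2−μ}` when `log y ≤ log 41 − μ²`, `μ ≥ 2`;
* `mul_exp_neg_le` — `μ e^{−μ} ≤ 6/μ²`; `windows_decay_a`, `windows_decay_b` — the two sums over
  `j < J` are `≤ 500/μ` and `≤ 134/μ`.

## References

* T. Tao, J. Teräväinen, *The Hardy–Littlewood–Chowla conjecture in the presence of a Siegel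
  zero*, J. London Math. Soc. 106 (2022), §3.3, remark after Proposition 3.5 ("taking a suitable
  linear combination of (3.13) and (3.14) for `m ≤ √log η`"). [TaoTeravainen2021]
-/

noncomputable section

open Finset

namespace Literature.NumberTheory.LFunctions.SiegelZero

/-! ### The ratio `11/10` -/

/-- `1/11 ≤ log(11/10) ≤ 1/10`. [folklore] -/
theorem log_eleven_tenths_bounds :
    1 / 11 ≤ Real.log (11 / 10 : ℝ) ∧ Real.log (11 / 10 : ℝ) ≤ 1 / 10 := by
  constructor
  · have h := Real.one_sub_inv_le_log_of_pos (show (0 : ℝ) < 11 / 10 by norm_num)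
    norm_num at h ⊢
    linarith
  · have h := Real.log_le_sub_one_of_pos (show (0 : ℝ) < 11 / 10 by norm_num)
    linarith

/-- **The number of windows**: for `μ ≥ 1` and `J = ⌊log μ / log(11/10)⌋`,
`(11/10)^J ≤ μ < (11/10)^{J+1}` and `J ≤ 11 log μ`. [folklore] -/
theorem geomIndex_bounds {μ : ℝ} (hμ : 1 ≤ μ) :
    (11 / 10 : ℝ) ^ ⌊Real.log μ / Real.log (11 / 10)⌋₊ ≤ μ ∧
      μ < (11 / 10 : ℝ) ^ (⌊Real.log μ / Real.log (11 / 10)⌋₊ + 1) ∧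
      (⌊Real.log μ / Real.log (11 / 10)⌋₊ : ℝ) ≤ 11 * Real.log μ := by
  obtain ⟨hl1, hl2⟩ := log_eleven_tenths_bounds
  have hl0 : 0 < Real.log (11 / 10 : ℝ) := by linarith
  have hμ0 : 0 < μ := by linarith
  have hlogμ : 0 ≤ Real.log μ := Real.log_nonneg hμ
  have hx0 : 0 ≤ Real.log μ / Real.log (11 / 10) := div_nonneg hlogμ hl0.le
  set J := ⌊Real.log μ / Real.log (11 / 10)⌋₊ with hJ
  have hJle : (J : ℝ) ≤ Real.log μ / Real.log (11 / 10) := Nat.floor_le hx0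
  have hJlt : Real.log μ / Real.log (11 / 10) < J + 1 := Nat.lt_floor_add_one _
  refine ⟨?_, ?_, ?_⟩
  · rw [← Real.rpow_natCast, ← Real.exp_log (show (0 : ℝ) < (11 / 10 : ℝ) ^ ((J : ℕ) : ℝ) by positivity),
      Real.log_rpow (by norm_num), ← Real.exp_log hμ0, Real.exp_le_exp]
    rwa [le_div_iff₀ hl0] at hJle
  · rw [← Real.rpow_natCast, ← Real.exp_log hμ0,
      ← Real.exp_log (show (0 : ℝ) < (11 / 10 : ℝ) ^ ((J + 1 : ℕ) : ℝ) by positivity),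
      Real.log_rpow (by norm_num), Real.exp_lt_exp]
    rw [div_lt_iff₀ hl0] at hJlt
    push_cast
    linarith
  · calc (J : ℝ) ≤ Real.log μ / Real.log (11 / 10) := hJle
      _ ≤ Real.log μ / (1 / 11) := div_le_div_of_nonneg_left hlogμ (by norm_num) hl1
      _ = 11 * Real.log μ := by ring

/-! ### The parameters of one window -/

/-- **Window parameters**: with `a = 4 (10/11)^j`, `a' = 4 (10/11)^{j+1}`, `m = ⌈(11/10)^{j+1}⌉`:
`0 < a' < a ≤ 4`, `a ≤ (11/10) a'`, `2 ≤ m`, `4 ≤ a' m`, `a m ≤ 42/5`. [folklore] -/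
theorem window_params (j : ℕ) :
    0 < 4 * (10 / 11 : ℝ) ^ (j + 1) ∧
      4 * (10 / 11 : ℝ) ^ (j + 1) < 4 * (10 / 11 : ℝ) ^ j ∧
      4 * (10 / 11 : ℝ) ^ j ≤ 4 ∧
      4 * (10 / 11 : ℝ) ^ j ≤ 11 / 10 * (4 * (10 / 11 : ℝ) ^ (j + 1)) ∧
      2 ≤ ⌈(11 / 10 : ℝ) ^ (j + 1)⌉₊ ∧
      4 ≤ 4 * (10 / 11 : ℝ) ^ (j + 1) * ⌈(11 / 10 : ℝ) ^ (j + 1)⌉₊ ∧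
      4 * (10 / 11 : ℝ) ^ j * ⌈(11 / 10 : ℝ) ^ (j + 1)⌉₊ ≤ 42 / 5 := by
  have hr0 : (0 : ℝ) < (10 / 11 : ℝ) ^ j := by positivity
  have hr1 : (10 / 11 : ℝ) ^ j ≤ 1 := pow_le_one₀ (by norm_num) (by norm_num)
  have hlam : (1 : ℝ) < (11 / 10 : ℝ) ^ (j + 1) := one_lt_pow₀ (by norm_num) (by omega)
  have hlam0 : (0 : ℝ) ≤ (11 / 10 : ℝ) ^ (j + 1) := by positivity
  have hinv : (10 / 11 : ℝ) ^ (j + 1) * (11 / 10 : ℝ) ^ (j + 1) = 1 := by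
    rw [← mul_pow]; norm_num
  have hceil_ge : (11 / 10 : ℝ) ^ (j + 1) ≤ ⌈(11 / 10 : ℝ) ^ (j + 1)⌉₊ := Nat.le_ceil _
  have hceil_lt : (⌈(11 / 10 : ℝ) ^ (j + 1)⌉₊ : ℝ) < (11 / 10 : ℝ) ^ (j + 1) + 1 :=
    Nat.ceil_lt_add_one hlam0
  have hpow_succ : (10 / 11 : ℝ) ^ (j + 1) = (10 / 11 : ℝ) ^ j * (10 / 11) := pow_succ _ _
  have hpow_succ' : (11 / 10 : ℝ) ^ (j + 1) = (11 / 10 : ℝ) ^ j * (11 / 10) := pow_succ _ _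
  have hinv' : (10 / 11 : ℝ) ^ j * (11 / 10 : ℝ) ^ j = 1 := by rw [← mul_pow]; norm_num
  refine ⟨by positivity, ?_, by linarith, ?_, ?_, ?_, ?_⟩
  · rw [hpow_succ]; nlinarith
  · rw [hpow_succ]; nlinarith
  · have h2 : (1 : ℕ) < ⌈(11 / 10 : ℝ) ^ (j + 1)⌉₊ := Nat.lt_ceil.mpr (by exact_mod_cast hlam)
    omega
  · calc (4 : ℝ) = 4 * ((10 / 11 : ℝ) ^ (j + 1) * (11 / 10 : ℝ) ^ (j + 1)) := by rw [hinv]; ring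
      _ ≤ 4 * (10 / 11 : ℝ) ^ (j + 1) * ⌈(11 / 10 : ℝ) ^ (j + 1)⌉₊ := by
          rw [mul_assoc]
          gcongr
  · calc 4 * (10 / 11 : ℝ) ^ j * ⌈(11 / 10 : ℝ) ^ (j + 1)⌉₊
        ≤ 4 * (10 / 11 : ℝ) ^ j * ((11 / 10 : ℝ) ^ (j + 1) + 1) := by gcongr
      _ = 4 * (11 / 10) * ((10 / 11 : ℝ) ^ j * (11 / 10 : ℝ) ^ j) + 4 * (10 / 11 : ℝ) ^ j := by
          rw [hpow_succ']; ring
      _ ≤ 4 * (11 / 10) * 1 + 4 * 1 := by rw [hinv']; gcongr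
      _ = 42 / 5 := by norm_num

/-- For `j < J` with `(11/10)^J ≤ μ`: `m_j = ⌈(11/10)^{j+1}⌉ ≤ μ + 1` (as reals). [folklore] -/
theorem ceil_pow_le_of_lt {μ : ℝ} {j J : ℕ} (hjJ : j < J) (hJ : (11 / 10 : ℝ) ^ J ≤ μ) :
    (⌈(11 / 10 : ℝ) ^ (j + 1)⌉₊ : ℝ) ≤ μ + 1 := by
  have h1 : (11 / 10 : ℝ) ^ (j + 1) ≤ (11 / 10 : ℝ) ^ J :=
    pow_le_pow_right₀ (by norm_num) (by omega)
  have h2 : (⌈(11 / 10 : ℝ) ^ (j + 1)⌉₊ : ℝ) < (11 / 10 : ℝ) ^ (j + 1) + 1 :=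
    Nat.ceil_lt_add_one (by positivity)
  linarith

/-- The exponents decrease: `a_{j+1} ≥ a_J` for `j < J`, i.e. `(10/11)^J ≤ (10/11)^{j+1}`. [folklore] -/
theorem pow_ratio_le_of_lt {j J : ℕ} (hjJ : j < J) :
    (10 / 11 : ℝ) ^ J ≤ (10 / 11 : ℝ) ^ (j + 1) :=
  pow_le_pow_of_le_one (by norm_num) (by norm_num) (by omega)

/-- **The last exponent**: with `(11/10)^J ≤ μ < (11/10)^{J+1}` and `μ > 0`,
`4/μ ≤ a_J = 4 (10/11)^J < (44/10)/μ`. [folklore] -/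
theorem lastExponent_bounds {μ : ℝ} {J : ℕ} (hμ : 0 < μ) (h1 : (11 / 10 : ℝ) ^ J ≤ μ)
    (h2 : μ < (11 / 10 : ℝ) ^ (J + 1)) :
    4 / μ ≤ 4 * (10 / 11 : ℝ) ^ J ∧ 4 * (10 / 11 : ℝ) ^ J < 44 / 10 / μ := by
  have hinv : (10 / 11 : ℝ) ^ J * (11 / 10 : ℝ) ^ J = 1 := by rw [← mul_pow]; norm_num
  have hpos : (0 : ℝ) < (10 / 11 : ℝ) ^ J := by positivity
  have hpos' : (0 : ℝ) < (11 / 10 : ℝ) ^ J := by positivity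
  constructor
  · rw [div_le_iff₀ hμ]
    calc (4 : ℝ) = 4 * ((10 / 11 : ℝ) ^ J * (11 / 10 : ℝ) ^ J) := by rw [hinv]; ring
      _ ≤ 4 * (10 / 11 : ℝ) ^ J * μ := by rw [mul_assoc]; gcongr
  · rw [lt_div_iff₀ hμ]
    rw [pow_succ] at h2
    calc 4 * (10 / 11 : ℝ) ^ J * μ < 4 * (10 / 11 : ℝ) ^ J * ((11 / 10 : ℝ) ^ J * (11 / 10)) := by
          gcongr
      _ = 44 / 10 * ((10 / 11 : ℝ) ^ J * (11 / 10 : ℝ) ^ J) := by ring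
      _ = 44 / 10 := by rw [hinv, mul_one]

/-! ### Decay estimates -/

/-- For `0 ≤ x ≤ 1` and `1 ≤ m ≤ M` (reals, `m` a natural number): `x^{1/m} ≤ x^{1/M}`. [folklore] -/
theorem rpow_inv_le_rpow_inv {x M : ℝ} {m : ℕ} (hx0 : 0 ≤ x) (hx1 : x ≤ 1) (hm : 1 ≤ m)
    (hmM : (m : ℝ) ≤ M) : x ^ (1 / (m : ℝ)) ≤ x ^ (1 / M) := by
  have hm0 : (0 : ℝ) < m := by exact_mod_cast hm
  have hM0 : 0 < M := lt_of_lt_of_le hm0 hmM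
  rcases hx0.eq_or_lt with h | h
  · rw [← h, Real.zero_rpow (one_div_pos.mpr hm0).ne', Real.zero_rpow (one_div_pos.mpr hM0).ne']
  · exact Real.rpow_le_rpow_of_exponent_ge h hx1 (one_div_le_one_div_of_le hm0 hmM)

/-- **The per-window factor decays**: for `μ ≥ 2`, `y > 0` with `log y ≤ log 41 − μ²`,
`y^{1/(μ+1)} ≤ e^{2−μ}` (`log 41 < 4 ≤ μ + 2`). [folklore] -/
theorem rpow_inv_le_exp_of_log_le {y μ : ℝ} (hμ : 2 ≤ μ) (hy : 0 < y)
    (hlog : Real.log y ≤ Real.log 41 - μ ^ 2) : y ^ (1 / (μ + 1)) ≤ Real.exp (2 - μ) := by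
  have hlog41 : Real.log 41 ≤ 4 := by
    have h1 : Real.log 41 ≤ Real.log (Real.exp 4) := by
      refine Real.log_le_log (by norm_num) ?_
      have he := Real.exp_one_gt_d9
      have h4 : Real.exp 4 = (Real.exp 1) ^ 4 := by
        rw [← Real.exp_nat_mul]; norm_num
      rw [h4]
      calc (41 : ℝ) ≤ (2.7182818283 : ℝ) ^ 4 := by norm_num
        _ ≤ (Real.exp 1) ^ 4 := by gcongr
    rwa [Real.log_exp] at h1
  have hμ1 : 0 < μ + 1 := by linarith
  rw [Real.rpow_def_of_pos hy, Real.exp_le_exp]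
  calc Real.log y * (1 / (μ + 1)) = Real.log y / (μ + 1) := by ring
    _ ≤ (Real.log 41 - μ ^ 2) / (μ + 1) := div_le_div_of_nonneg_right hlog hμ1.le
    _ ≤ 2 - μ := by
        rw [div_le_iff₀ hμ1]
        nlinarith

/-- `μ e^{−μ} ≤ 6/μ²` for `μ > 0` (from `μ³/6 ≤ e^μ`). [folklore] -/
theorem mul_exp_neg_le {μ : ℝ} (hμ : 0 < μ) : μ * Real.exp (-μ) ≤ 6 / μ ^ 2 := by
  have h := Real.pow_div_factorial_le_exp (x := μ) hμ.le 3
  have h3 : (Nat.factorial 3 : ℝ) = 6 := by norm_num [Nat.factorial]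
  rw [h3] at h
  rw [Real.exp_neg, le_div_iff₀ (by positivity)]
  have hexp : 0 < Real.exp μ := Real.exp_pos μ
  calc μ * (Real.exp μ)⁻¹ * μ ^ 2 = μ ^ 3 / Real.exp μ := by field_simp
    _ ≤ 6 := by
        rw [div_le_iff₀ hexp]
        have := (div_le_iff₀ (by norm_num : (0 : ℝ) < 6)).mp h
        linarith

/-- **Sum of the window factors**: for `μ ≥ 2`, `11 log μ · e^{2−μ} ≤ 500/μ`. [folklore] -/
theorem windows_decay_a {μ : ℝ} (hμ : 2 ≤ μ) : 11 * Real.log μ * Real.exp (2 - μ) ≤ 500 / μ := by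
  have hμ0 : 0 < μ := by linarith
  have hlogμ : Real.log μ ≤ μ := (Real.log_le_sub_one_of_pos hμ0).trans (by linarith)
  have hlog0 : 0 ≤ Real.log μ := Real.log_nonneg (by linarith)
  have hdecay := mul_exp_neg_le hμ0
  have he2 : Real.exp 2 ≤ 8 := by
    have h1 : (2 : ℝ) ≤ Real.log 8 := by
      have h8 : Real.log 8 = 3 * Real.log 2 := by
        rw [show (8 : ℝ) = 2 ^ 3 by norm_num, Real.log_pow]; norm_num
      rw [h8]
      have := Real.log_two_gt_d9
      linarith
    calc Real.exp 2 ≤ Real.exp (Real.log 8) := Real.exp_le_exp.mpr h1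
      _ = 8 := Real.exp_log (by norm_num)
  have hsplit : Real.exp (2 - μ) = Real.exp 2 * Real.exp (-μ) := by
    rw [← Real.exp_add]; ring_nf
  rw [hsplit]
  calc 11 * Real.log μ * (Real.exp 2 * Real.exp (-μ))
      = 11 * Real.exp 2 * (Real.log μ * Real.exp (-μ)) := by ring
    _ ≤ 11 * 8 * (μ * Real.exp (-μ)) := by
        gcongr
    _ ≤ 11 * 8 * (6 / μ ^ 2) := by gcongr
    _ = 528 / μ / μ := by field_simp; ring
    _ ≤ 528 / μ / 2 := div_le_div_of_nonneg_left (by positivity) (by norm_num) hμ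
    _ ≤ 500 / μ := by
        rw [div_div, div_le_div_iff₀ (by positivity) hμ0]
        nlinarith

/-- **Sum of the tiny terms**: for `μ ≥ 2`, `11 log μ · (2.02 e^{−μ}) ≤ 134/μ`. [folklore] -/
theorem windows_decay_b {μ : ℝ} (hμ : 2 ≤ μ) :
    11 * Real.log μ * (202 / 100 * Real.exp (-μ)) ≤ 134 / μ := by
  have hμ0 : 0 < μ := by linarith
  have hlogμ : Real.log μ ≤ μ := (Real.log_le_sub_one_of_pos hμ0).trans (by linarith)
  have hlog0 : 0 ≤ Real.log μ := Real.log_nonneg (by linarith)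
  have hdecay := mul_exp_neg_le hμ0
  calc 11 * Real.log μ * (202 / 100 * Real.exp (-μ))
      = 2222 / 100 * (Real.log μ * Real.exp (-μ)) := by ring
    _ ≤ 2222 / 100 * (μ * Real.exp (-μ)) := by gcongr
    _ ≤ 2222 / 100 * (6 / μ ^ 2) := by gcongr
    _ = 13332 / 100 / μ / μ := by field_simp; ring
    _ ≤ 13332 / 100 / μ / 2 := div_le_div_of_nonneg_left (by positivity) (by norm_num) hμ
    _ ≤ 134 / μ := by
        rw [div_div, div_le_div_iff₀ (by positivity) hμ0]
        nlinarith

/-- **Summing `J` equal bounds**: if each of the `J` window terms is `≤ B` with `B ≥ 0`, the sum over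
`j < J` is `≤ J · B`. [folklore] -/
theorem sum_range_le_mul {J : ℕ} {f : ℕ → ℝ} {B : ℝ} (h : ∀ j, j < J → f j ≤ B) :
    ∑ j ∈ range J, f j ≤ J * B := by
  calc ∑ j ∈ range J, f j ≤ ∑ _j ∈ range J, B := Finset.sum_le_sum fun j hj => h j (mem_range.mp hj)
    _ = J * B := by rw [Finset.sum_const, Finset.card_range, nsmul_eq_mul]

end Literature.NumberTheory.LFunctions.SiegelZero

end
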